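import Literature.Topology.FourManifolds.SlideContext
import Literature.Topology.FourManifolds.SublevelDiffeoControlled
import Literature.AlgebraicTopology.FundamentalGroup.FlowTracks
import HarnessLib

/-!
# The handle-slide diffeomorphism of a `1`-handlebody and its effect on the fundamental group

Topic `Literature/Topology/FourManifolds` (fact seat
`provefact-Literature.Topology.FourManifolds.lauden-f709dd520c`, Laudenbach–Poénaru's Lemma 2: the
slide `H₃` / flip `H₂` of a `1`-handle as a self-diffeomorphism of the handlebody, p. 340, and
its effect `x₁ ↦ x₁x₂`, `xᵢ ↦ xᵢ` on `π₁`).  Everything here is **proved**; no named facts.  The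
file has three parts (originally drafted as `SlideSeed`, `SlideHomotopy`, `SlidePi1`).

## Part 1 — the slide diffeomorphism from a diffeotopy of the seed level fixing the feet

For a slide context `C` (`SlideContext.lean`: Milnor's handle-extension data with both sides
equal, no shift, identity seed) and a diffeotopy `ψ` of the seed level `V = f⁻¹(c)` whose final
stage fixes the two flowed-down feet discs of the handle on their closed unit parameter balls
(`SlideContext.IsSeed`; e.g. a point push of one foot around a loop returning to the identity
near the feet):

* `SlideContext.susp ψ` — the suspension `κ` of `ψ` along the unit-speed flow
  (`LevelDiffeotopySuspension.lean`), a level-preserving self-diffeomorphism of `M`, and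
  `seedPair`: `(κ, κ⁻¹)` is a lower pair at the seed level (`IsLowerPair.postcomp` of the identity
  seed), carrying the flowed-down feet to themselves (`seed_feet`) — the rôle played in the
  two-manifold step `OneHandleStep.lean` by the corrected seed, *without* the two-disc
  correction;
* `exists_extended_pair` — its extension up the slab to the level `a + 2η₀`
  (`IsLowerPair.exists_extend`), equal to the (identity) chart correspondence on the feet at the
  level `a`, together with the facts dropped in `OneHandleStep.lean`: the extension is `κ`
  below the level `c` and the flow conjugate `x ↦ θ (f x - c, κ (θ (c - f x, x)))` on
  `c ≤ f < a + 2η₀`;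
* `exists_diffeomorph` — **the slide diffeomorphism**: with the handle pair `P` of the extended
  pair (`OneHandleStepContext.pair`, both sides `C.S`), a self-diffeomorphism `Ψ` of `M` equal
  to the handle-extension map `P.hetMap` (`HandleConjugation.lean`) at every point with
  `f ≤ ℓ⁺ - 3δ` (`Ψ = G⁻¹ ∘ Φ ∘ G'` with `Φ = P.diffeomorphSublevel` on `{f ≤ ℓ⁺ - 2δ}` and pushes
  `G`, `G'` equal to the identity below `ℓ⁺ - 3δ`, `SublevelDiffeoControlled.lean`).

## Part 2 — the slide diffeomorphism below the handle, and its isotopy to the identity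

* `HandleChart.chartMap_self` — the chart correspondence of a handle chart with itself is the
  identity; hence `hetMap = id` on the handle region for equal sides (`hetMap_eq_self_of_mem`);
* `hetMap_eq_of_lt`, `hetMap_eq_conj` — below `c` the handle-extension map is `κ`, and on
  `c ≤ f < a + η/2` it is the flow conjugate of `κ` (`IsLowerPair.low_eq_conj`);
* `suspFamily s` — the suspension of the truncated diffeotopy `u ↦ ψ_{s u}` (`= id` at `s = 0`,
  `= κ` at `s = 1`), **jointly continuous in `(s, y)`** (`continuous_suspFamily`);
* `slideHomotopy` — the homotopy `H (s, x) = θ (T x, suspFamily s (θ (-T x, x)))`,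
  `T x = max (f x - c) 0`, on `X = {f ≤ a - η}`, from the inclusion to
  `x ↦ θ (T x, κ (θ (-T x, x)))`; its track at a point `θ (t, v)` of the flow line of a point `v`
  of the seed level is `s ↦ θ (t, ψ_s v)` (`slideHomotopyFun_flow`), and it is constant below
  `c - 3τ` (`slideHomotopyFun_of_le`).

## Part 3 — the effect on `π₁`

With `Ψ` from Part 1, `X = {f ≤ a - η}`, the inclusion `i : X → M`, a base point `x₀` below
`c - 3τ`, the cut points `y± = θ (a - η - c, v±)` of the centres `v±` of the two discs, paths
`α± : x₀ ⟶ y±` in `X` and a path `K : y₋ ⟶ y₊` in `M` fixed pointwise by `Ψ`: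

* `slide_apply_of_le_cut` — on `X`, `Ψ` is the flow conjugate of `κ` (so the slide homotopy
  ends at `Ψ ∘ i`); `slide_flow_levelIncl` — `Ψ` fixes the flow line of every point of the seed
  level fixed by `ψ₁`; `slide_eq_self_of_mem_N` — `Ψ = id` on the handle region;
* `mapOfEq_slide_loop` — **`Ψ_#` fixes the classes of the loops of `X` at `x₀`**;
* `mapOfEq_slide_arcLoop` — **the slide formula**
  `Ψ_# [α₋ · K · α₊⁻¹] = [α₋ · K · α₊⁻¹] · [α₊ · τ₊ · α₊⁻¹]⁻¹`, `τ₊ s = θ (a - η - c, ψ_s v₊)` the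
  flowed-up track of `v₊` (`IsotopyTrack.mapOfEq_mk_arcLoop_of_slide`), when every stage of `ψ`
  fixes `v₋` and the final one fixes `v₊`;
* `mk_levelTrack_eq` — `[λ₊] = [O] · [τ₊] · [O]⁻¹` for the track `λ₊ s = ψ_s v₊` in the seed level
  and the orbit segment `O : v₊ ⟶ y₊` (`FlowTracks.lean`).

## References

* J. Milnor, *Lectures on the h-cobordism theorem* (1965), proofs of Thm. 3.4 (PDF p. 13) and
  Thm. 3.13 (PDF pp. 18–19). [MilnorHCobordism1965]
* F. Laudenbach, V. Poénaru, *A note on 4-dimensional handlebodies*, Bull. Soc. Math. France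
  100 (1972), proof of Lemma 2 (p. 340). [LaudenbachPoenaruBSMF1972]
* A. Hatcher, *Algebraic Topology* (2002), Lemma 1.19. [HatcherAT2002]
-/

open scoped Manifold ContDiff Topology unitInterval
open Set Function Filter Metric Module
open Literature.AlgebraicTopology.FundamentalGroup

noncomputable section

namespace Literature.Topology.FourManifolds

universe u

/-! ## Part 1 — the slide diffeomorphism -/

/-- Local notation: `𝔼 n` is the model Euclidean space `EuclideanSpace ℝ (Fin n)`. -/
local notation "𝔼 " n:arg => EuclideanSpace ℝ (Fin n)

namespace SlideContext

variable {n : ℕ} {M : Type u} [TopologicalSpace M] [ChartedSpace (EuclideanHalfSpace (n + 1)) M]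
  [IsManifold (𝓡∂ (n + 1)) ∞ M] [T2Space M] (C : SlideContext n M)

/-! ### Seeds -/

/-- **A seed diffeotopy** of the seed level: its final stage fixes the two flowed-down feet
discs of the handle on the closed unit parameter balls. [cite: MilnorHCobordism1965, proof of Thm. 3.13 (PDF pp. 18–19)] -/
structure IsSeed (ψ : Diffeotopy (𝓡 n) (C.toCtx.Sl'.Level (C.toCtx.c + C.toCtx.σ))) : Prop where
  /-- The `+` disc is fixed at time `1`. -/
  fix_pos : ∀ w : 𝔼 n, ‖w‖ ≤ 1 → ψ.toFun 1 (C.toCtx.disc' (one_pow 2) w) = C.toCtx.disc' (one_pow 2) w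
  /-- The `-` disc is fixed at time `1`. -/
  fix_neg : ∀ w : 𝔼 n, ‖w‖ ≤ 1 → ψ.toFun 1 (C.toCtx.disc' neg_one_sq w) = C.toCtx.disc' neg_one_sq w

variable (ψ : Diffeotopy (𝓡 n) (C.toCtx.Sl'.Level (C.toCtx.c + C.toCtx.σ)))

/-- **The suspension of the seed diffeotopy** along the unit-speed flow, about the seed level.
[cite: MilnorHCobordism1965, proof of Thm. 3.13 (PDF pp. 18–19)] -/
def susp : M ≃ₘ⟮𝓡∂ (n + 1), 𝓡∂ (n + 1)⟯ M :=
  C.toCtx.Sl'.suspDiffeomorph (c := C.toCtx.c + C.toCtx.σ) C.toCtx.τ_pos C.toCtx.lo'_le C.toCtx.le_hi' rfl C.toCtx.hn1 ψ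

omit [T2Space M] in
/-- The suspension preserves `f`. [folklore] -/
theorem apply_susp (y : M) : C.S.f (C.susp ψ y) = C.S.f y :=
  C.toCtx.Sl'.apply_suspDiffeomorph C.toCtx.τ_pos C.toCtx.lo'_le C.toCtx.le_hi' rfl C.toCtx.hn1 ψ y

omit [T2Space M] in
/-- The suspension is the identity below `c - 2τ` and above `c + 3τ`. [folklore] -/
theorem susp_eq_self {y : M} (hy : C.S.f y ≤ C.c - 2 * C.τ ∨ C.c + 3 * C.τ ≤ C.S.f y) : C.susp ψ y = y := by
  refine C.toCtx.Sl'.suspDiffeomorph_eq_self C.toCtx.τ_pos C.toCtx.lo'_le C.toCtx.le_hi' rfl C.toCtx.hn1 ψ ?_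
  show C.S.f y ≤ C.c + 0 - 2 * C.τ ∨ C.c + 0 + 3 * C.τ ≤ C.S.f y
  simpa using hy

omit [T2Space M] in
/-- **The suspension on the plateau is the flow conjugate of the final stage**: for a point `v`
of the seed level and `t ∈ [-τ, 2τ]`, `κ (θ (t, v)) = θ (t, ψ₁ v)`. [cite: MilnorHCobordism1965, proof of Thm. 3.13 (PDF pp. 18–19)] -/
theorem susp_flow (v : C.toCtx.Sl'.Level (C.toCtx.c + C.toCtx.σ)) {t : ℝ} (ht : t ∈ Icc (-C.τ) (2 * C.τ)) :
    C.susp ψ (C.S.θ (t, C.toCtx.Sl'.levelIncl v)) = C.S.θ (t, C.toCtx.Sl'.levelIncl (ψ.toFun 1 v)) :=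
  C.toCtx.Sl'.suspDiffeomorph_flow C.toCtx.τ_pos C.toCtx.lo'_le C.toCtx.le_hi' rfl C.toCtx.hn1 ψ v ht

omit [T2Space M] in
/-- In particular on the seed level itself `κ = ψ₁`. [folklore] -/
theorem susp_levelIncl (v : C.toCtx.Sl'.Level (C.toCtx.c + C.toCtx.σ)) :
    C.susp ψ (C.toCtx.Sl'.levelIncl v) = C.toCtx.Sl'.levelIncl (ψ.toFun 1 v) := by
  have h := C.susp_flow ψ v (t := 0) ⟨by linarith [C.τ_pos], by linarith [C.τ_pos]⟩
  rwa [C.S.isFlowOf.map_zero, C.S.isFlowOf.map_zero] at h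

/-- **The seed lower pair** `(κ, κ⁻¹)` at the level `c + τ`, of width `τ/3`. [cite: MilnorHCobordism1965, proof of Thm. 3.13 (PDF pp. 18–19)] -/
theorem seedPair : IsLowerPair C.toCtx.Sl C.toCtx.Sl' C.toCtx.σ (C.toCtx.c + C.toCtx.τ) (C.toCtx.τ / 3)
    (C.susp ψ ∘ C.toCtx.g₀) (C.toCtx.g₀' ∘ (C.susp ψ).symm) := by
  refine C.toCtx.seed.postcomp (by show 0 < C.τ / 3; linarith [C.τ_pos]) (C.susp ψ)
    (fun y => C.toCtx.Sl'.apply_suspDiffeomorph C.toCtx.τ_pos C.toCtx.lo'_le C.toCtx.le_hi' rfl C.toCtx.hn1 ψ y)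
    fun y t hy ht => ?_
  have hτ := C.τ_pos
  exact C.toCtx.Sl'.suspDiffeomorph_flow_of_mem C.toCtx.τ_pos C.toCtx.lo'_le C.toCtx.le_hi' rfl C.toCtx.hn1 ψ
    ⟨by show C.c + 0 - C.τ ≤ _; have := hy.1; simp only [toCtx_σ, toCtx_c, toCtx_τ] at this ⊢; linarith,
     by show _ ≤ C.c + 0 + 2 * C.τ; have := hy.2; simp only [toCtx_σ, toCtx_c, toCtx_τ] at this ⊢; linarith⟩
    ⟨by show C.c + 0 - C.τ ≤ _; have := ht.1; simp only [toCtx_σ, toCtx_c, toCtx_τ] at this ⊢; linarith,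
     by show _ ≤ C.c + 0 + 2 * C.τ; have := ht.2; simp only [toCtx_σ, toCtx_c, toCtx_τ] at this ⊢; linarith⟩

variable {ψ}

omit [T2Space M] in
/-- **The seed carries the flowed-down feet to themselves** (final stage of `ψ` fixes the
discs). [cite: MilnorHCobordism1965, proof of Thm. 3.13 (PDF pp. 18–19)] -/
theorem seed_feet (hψ : C.IsSeed ψ) {s : ℝ} (hs : s ^ 2 = 1) (w : 𝔼 n) (hw : ‖w‖ ≤ 1) (hs1 : s = 1 ∨ s = -1) :
    (C.susp ψ ∘ C.toCtx.g₀) (C.toCtx.Sl.levelIncl (C.toCtx.Λ (C.toCtx.T.footLift C.toCtx.ρ_pos C.toCtx.hmR hs w))) =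
      C.toCtx.Sl'.levelIncl (C.toCtx.Λ' (C.toCtx.T'.footLift C.toCtx.ρ_pos C.toCtx.hmR' hs w)) := by
  show C.susp ψ (C.toCtx.g₀ (C.toCtx.Sl.levelIncl (C.toCtx.Λ (C.toCtx.T.footLift C.toCtx.ρ_pos C.toCtx.hmR hs w)))) = _
  have h1 : C.toCtx.g₀ (C.toCtx.Sl.levelIncl (C.toCtx.Λ (C.toCtx.T.footLift C.toCtx.ρ_pos C.toCtx.hmR hs w))) =
      C.toCtx.Sl'.levelIncl (C.toCtx.disc hs w) := rfl
  rw [h1, C.susp_levelIncl, C.toCtx_disc_eq_disc' hs w]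
  rcases hs1 with rfl | rfl
  · exact congrArg C.toCtx.Sl'.levelIncl (hψ.fix_pos w hw)
  · exact congrArg C.toCtx.Sl'.levelIncl (hψ.fix_neg w hw)

/-! ### The extension up the slab -/

/-- **The extended pair of a seed**, as in `OneHandleStepContext.exists_extended_pair` but from
the suspension of a seed diffeotopy and *keeping* the description of the extension: a lower pair
`(g, g')` at the level `a + 2η₀`, of a width `η₀ ∈ (η/2, 2η/3]`, equal to the chart
correspondence (here the identity) on the feet at the level `a`, equal to `κ` below the level
`c` and to the flow conjugate of `κ` on `c ≤ f < a + 2η₀`. [cite: MilnorHCobordism1965, proofs of Thm. 3.4 (PDF p. 13) and Thm. 3.13 (PDF pp. 18–19)] -/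
theorem exists_extended_pair (hψ : C.IsSeed ψ) :
    ∃ (g g' : M → M) (η₀ : ℝ) (N : ℕ), C.S.η / 2 < η₀ ∧ η₀ ≤ 2 * C.S.η / 3 ∧
      C.toCtx.c + C.toCtx.τ + N * η₀ = C.S.a + 2 * η₀ ∧
      IsLowerPair C.toCtx.Sl C.toCtx.Sl' C.toCtx.σ (C.toCtx.c + C.toCtx.τ + N * η₀) η₀ g g' ∧
      (∀ {s : ℝ} (hs : s ^ 2 = 1) (w : 𝔼 n), ‖w‖ ≤ 1 → (s = 1 ∨ s = -1) →
        g (C.S.D.foot s C.toCtx.m C.toCtx.ρ w) = C.S.D.foot s C.toCtx.m' C.toCtx.ρ w) ∧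
      (∀ x, C.S.f x < C.c → g x = C.susp ψ x) ∧
      ∀ x, C.c ≤ C.S.f x → C.S.f x < C.toCtx.c + C.toCtx.τ + N * η₀ →
        g x = C.S.θ (C.S.f x - C.c, C.susp ψ (C.S.θ (C.c - C.S.f x, x))) := by
  have hP₁ := C.seedPair ψ
  have hfeet₁ := fun {s : ℝ} (hs : s ^ 2 = 1) => C.seed_feet hψ hs
  have hτ := C.τ_pos; have hη := C.S.η_pos
  -- the arithmetic of the steps (verbatim from `OneHandleStepContext.exists_extended_pair`)
  set L : ℝ := C.S.a - C.c - C.τ with hL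
  have hLτ : 7 * C.τ + 24 * C.S.ε ^ 2 ≤ L := by rw [hL]; have := C.toCtx.c_le; simp only [toCtx_c, toCtx_τ, toCtx_S] at this; linarith
  have hLpos : 0 < L := by linarith [sq_nonneg C.S.ε]
  have hLη : 2 * C.S.η ≤ L := by linarith [C.hητ, sq_nonneg C.S.ε]
  set q : ℝ := 3 * L / (2 * C.S.η) with hq
  have hqpos : 0 < q := by rw [hq]; positivity
  set N' : ℕ := ⌈q⌉₊ with hN'
  have hN'q : q ≤ N' := Nat.le_ceil q
  have hN'lt : (N' : ℝ) < q + 1 := Nat.ceil_lt_add_one hqpos.le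
  have hN'pos : (0 : ℝ) < N' := lt_of_lt_of_le hqpos hN'q
  set η₀ : ℝ := L / N' with hη₀
  have hη₀pos : 0 < η₀ := div_pos hLpos hN'pos
  have hη₀le : η₀ ≤ 2 * C.S.η / 3 := by
    rw [hη₀, div_le_iff₀ hN'pos]
    have : 3 * L / (2 * C.S.η) * (2 * C.S.η / 3) = L := by field_simp
    nlinarith
  have hη₀gt : C.S.η / 2 < η₀ := by
    rw [hη₀, lt_div_iff₀ hN'pos]
    have : (q + 1) * (C.S.η / 2) ≤ L := by
      rw [hq]
      have : 3 * L / (2 * C.S.η) * (C.S.η / 2) = 3 * L / 4 := by field_simp; ring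
      nlinarith
    nlinarith
  set N : ℕ := N' + 2 with hN
  have hNη₀ : (N : ℝ) * η₀ = L + 2 * η₀ := by
    rw [hN]; push_cast
    have : (N' : ℝ) * η₀ = L := by rw [hη₀]; field_simp
    linarith [this]
  have hA : C.toCtx.c + C.toCtx.τ + N * η₀ = C.S.a + 2 * η₀ := by
    show C.c + C.τ + N * η₀ = C.S.a + 2 * η₀; rw [hNη₀, hL]; ring
  -- the extension
  have hlo : C.toCtx.Sl.lo ≤ C.toCtx.c - C.toCtx.τ := by show C.S.ℓ₁ ≤ C.c - C.τ; rw [C.hℓ₁_eq]; linarith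
  have hlo' : C.toCtx.Sl'.lo ≤ C.toCtx.c + C.toCtx.σ - C.toCtx.τ := by show C.S.ℓ₁ ≤ C.c + 0 - C.τ; rw [C.hℓ₁_eq]; linarith
  have hc_le : C.c + 8 * C.τ ≤ C.S.a - 24 * C.S.ε ^ 2 := by
    have := C.toCtx.c_le; simpa only [toCtx_c, toCtx_τ, toCtx_S] using this
  have hhi : C.toCtx.c + C.toCtx.τ + C.toCtx.τ / 3 ≤ C.toCtx.Sl.hi := by
    show C.c + C.τ + C.τ / 3 ≤ C.S.a + 2 * C.S.η; linarith [sq_nonneg C.S.ε]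
  have hhi' : C.toCtx.c + C.toCtx.σ + C.toCtx.τ + C.toCtx.τ / 3 ≤ C.toCtx.Sl'.hi := by
    show C.c + 0 + C.τ + C.τ / 3 ≤ C.S.a + 2 * C.S.η; linarith [sq_nonneg C.S.ε]
  have hη₀τ : 18 * η₀ ≤ 5 * C.toCtx.τ := by show 18 * η₀ ≤ 5 * C.τ; linarith [C.hητ]
  have hNhi : C.toCtx.c + C.toCtx.τ + N * η₀ ≤ C.toCtx.Sl.hi := by show _ ≤ C.S.a + 2 * C.S.η; rw [hA]; linarith
  have hNhi' : C.toCtx.c + C.toCtx.σ + C.toCtx.τ + N * η₀ ≤ C.toCtx.Sl'.hi := by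
    show C.c + 0 + C.τ + N * η₀ ≤ C.S.a + 2 * C.S.η
    have hA' : C.c + C.τ + N * η₀ = C.S.a + 2 * η₀ := hA
    linarith
  obtain ⟨g, g', hP, hbelow, -, hconj⟩ := IsLowerPair.exists_extend C.toCtx.τ_pos hP₁ hlo hlo' hhi hhi' hη₀pos hη₀τ N hNhi hNhi'
  refine ⟨g, g', η₀, N, hη₀gt, hη₀le, hA, hP, fun {s} hs w hw hs1 => ?_, fun x hx => ?_, fun x hcx hx => ?_⟩
  · -- the feet (verbatim)
    have hfv : C.S.f (C.S.D.foot s C.toCtx.m C.toCtx.ρ w) = C.S.f C.S.p - C.toCtx.m := C.toCtx.T.apply_foot C.toCtx.ρ_pos C.toCtx.hmR hs w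
    have h1 := hconj (C.S.D.foot s C.toCtx.m C.toCtx.ρ w)
      (by show C.c ≤ C.S.f _; rw [hfv]; have := C.toCtx.fp_sub_m; simp only [toCtx_S] at this; rw [this]; linarith [sq_nonneg C.S.ε])
      (by show C.S.f _ < _; rw [hfv]; have := C.toCtx.fp_sub_m; simp only [toCtx_S] at this; rw [this, hA]; linarith)
    rw [show C.toCtx.Sl.f (C.S.D.foot s C.toCtx.m C.toCtx.ρ w) = C.S.f C.S.p - C.toCtx.m from hfv] at h1
    rw [h1]
    have h2 : C.toCtx.Sl.θ (C.toCtx.c - (C.S.f C.S.p - C.toCtx.m), C.S.D.foot s C.toCtx.m C.toCtx.ρ w) =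
        C.toCtx.Sl.levelIncl (C.toCtx.Λ (C.toCtx.T.footLift C.toCtx.ρ_pos C.toCtx.hmR hs w)) := rfl
    rw [h2, hfeet₁ hs w hw hs1]
    show C.S.θ (C.S.f C.S.p - C.toCtx.m - C.c, C.S.θ (C.c + 0 - (C.S.f C.S.p - C.toCtx.m'), C.S.D.foot s C.toCtx.m' C.toCtx.ρ w)) = _
    rw [C.S.isFlowOf.map_add, toCtx_m', show C.S.f C.S.p - C.toCtx.m - C.c + (C.c + 0 - (C.S.f C.S.p - C.toCtx.m)) = 0 by ring,
      C.S.isFlowOf.map_zero]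
  · exact hbelow x hx
  · exact hconj x hcx hx

/-! ### The slide diffeomorphism -/

/-- **The slide diffeomorphism of a seed.**  With the extended pair `(g, g')` of a seed
diffeotopy `ψ` and its handle pair `P` (both sides `C.S`), there is a self-diffeomorphism `Ψ`
of the compact manifold `M` which agrees with the handle-extension map `P.hetMap` at every
point with `f ≤ ℓ⁺ - 3δ`; and `g` is the suspension `κ` of `ψ` below the level `c` and its flow
conjugate on `c ≤ f < a + 2η₀`. [cite: MilnorHCobordism1965, proof of Thm. 3.13 (PDF pp. 18–19)]
[cite: LaudenbachPoenaruBSMF1972, proof of Lemma 2 (p. 340)] -/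
theorem exists_diffeomorph [CompactSpace M] (hψ : C.IsSeed ψ) :
    ∃ (g g' : M → M) (η₀ : ℝ) (N : ℕ) (hη₀ : C.toCtx.S.η / 2 < η₀) (hη₀' : η₀ ≤ 2 * C.toCtx.S.η / 3)
      (hA : C.toCtx.c + C.toCtx.τ + N * η₀ = C.toCtx.S.a + 2 * η₀)
      (hP : IsLowerPair C.toCtx.Sl C.toCtx.Sl' C.toCtx.σ (C.toCtx.c + C.toCtx.τ + N * η₀) η₀ g g')
      (hfeet : ∀ {s : ℝ} (hs : s ^ 2 = 1) (w : 𝔼 n), ‖w‖ ≤ 1 → (s = 1 ∨ s = -1) →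
        g (C.toCtx.S.D.foot s C.toCtx.m C.toCtx.ρ w) = C.toCtx.S'.D.foot s C.toCtx.m' C.toCtx.ρ w)
      (Ψ : M ≃ₘ⟮𝓡∂ (n + 1), 𝓡∂ (n + 1)⟯ M),
      (∀ x, C.S.f x < C.c → g x = C.susp ψ x) ∧
      (∀ x, C.c ≤ C.S.f x → C.S.f x < C.toCtx.c + C.toCtx.τ + N * η₀ →
        g x = C.S.θ (C.S.f x - C.c, C.susp ψ (C.S.θ (C.c - C.S.f x, x)))) ∧
      ∀ x, C.S.f x ≤ C.S.ℓu - 3 * C.S.δ → Ψ x = (C.toCtx.pair hη₀ hη₀' hA hP hfeet).hetMap x := by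
  obtain ⟨g, g', η₀, N, hη₀, hη₀', hA, hP, hfeet, hbelow, hconj⟩ := C.exists_extended_pair hψ
  refine ⟨g, g', η₀, N, hη₀, hη₀', hA, hP, hfeet, ?_⟩
  set P := C.toCtx.pair hη₀ hη₀' hA hP hfeet with hPdef
  have hε := C.S.ε_pos; have hη := C.S.η_pos; have hδ := C.S.δ_pos
  have hσ : P.σ = 0 := by show C.S.f C.S.p - C.S.f C.S.p = 0; ring
  have hPf : P.S.f = C.S.f := rfl
  -- the top level `b = ℓ⁺ - 2δ` and regularity above it (as in `nonempty_diffeomorph`)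
  set b : ℝ := C.S.ℓu - 2 * C.S.δ with hb
  have hregb : ∀ x, b ≤ P.S.f x → mfderiv (𝓡∂ (n + 1)) 𝓘(ℝ, ℝ) P.S.f x ≠ 0 := by
    intro x hx
    have hx' : C.S.ℓu - 2 * C.S.δ ≤ C.S.f x := hx
    rw [C.hℓu_eq, C.hδ_eq] at hx'
    have hxp : x ≠ C.S.p := fun h => by rw [h] at hx'; nlinarith
    exact C.hreg x (by have := C.hcτ; nlinarith [C.τ_pos]) hxp
  have hbd : ∀ x ∈ (𝓡∂ (n + 1)).boundary M, P.S.f x = 1 := fun x hx => (C.hF.2.1 x hx).1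
  have hlt : ∀ x ∈ (𝓡∂ (n + 1)).interior M, P.S.f x < 1 := fun x hx => C.hF.2.2 x hx
  have hb1 : b < 1 := by rw [hb, C.hℓu_eq, C.hδ_eq]; have := C.htop; nlinarith
  have hb₁ : P.S.a + P.S.η ≤ b := by
    show C.S.a + C.S.η ≤ b; rw [hb, C.ha_eq, C.hℓu_eq, C.hδ_eq]; have := C.hηε; nlinarith
  have hb₂ : b ≤ P.S.ℓu - 2 * P.S.δ := le_rfl
  have hint : ∀ p, P.S.f p ≤ b → (𝓡∂ (n + 1)).IsInteriorPoint p := fun p hp =>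
    ((𝓡∂ (n + 1)).isInteriorPoint_or_isBoundaryPoint p).resolve_right fun hb' => by
      have := hbd p hb'; linarith
  have hreg' : ∀ p, P.S.f p = b → ¬ IsMCriticalPt (𝓡∂ (n + 1)) P.S.f p := fun p hp hc => hregb p hp.ge hc
  -- the same data at the level `b + P.σ` (`P.σ = 0`, but not syntactically)
  have hregbσ : ∀ x, b + P.σ ≤ P.S'.f x → mfderiv (𝓡∂ (n + 1)) 𝓘(ℝ, ℝ) P.S'.f x ≠ 0 := fun x hx =>
    hregb x (by rw [hσ, add_zero] at hx; exact hx)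
  have hb1σ : b + P.σ < 1 := by rw [hσ, add_zero]; exact hb1
  have hintσ : ∀ p, P.S'.f p ≤ b + P.σ → (𝓡∂ (n + 1)).IsInteriorPoint p := fun p hp =>
    hint p (by rw [hσ, add_zero] at hp; exact hp)
  have hregσ' : ∀ p, P.S'.f p = b + P.σ → ¬ IsMCriticalPt (𝓡∂ (n + 1)) P.S'.f p := fun p hp =>
    hreg' p (by rw [hσ, add_zero] at hp; exact hp)
  letI csb := (sublevelAtlas P.S.hf b hint hreg').chartedSpace
  letI csb' := (sublevelAtlas P.S'.hf (b + P.σ) hintσ hregσ').chartedSpace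
  -- the handle-extension diffeomorphism of the sublevel sets
  set Φ := P.diffeomorphSublevel C.toCtx.hn1 hb₁ hb₂ hint hreg' hintσ hregσ' with hΦ
  -- the two pushes, each the identity below `b - δ`, `b + P.σ - δ`
  obtain ⟨amax, hamax, ha⟩ := exists_diffeomorph_sublevel_apply_eq_eq_self C.toCtx.hn1 P.S.hf hbd hlt hb1 hregb hint hreg' hδ
  obtain ⟨amax', hamax', ha'⟩ := exists_diffeomorph_sublevel_apply_eq_eq_self C.toCtx.hn1 P.S'.hf hbd hlt hb1σ hregbσ hintσ hregσ' hδ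
  obtain ⟨G, -, -, -, hGid⟩ := ha amax hamax le_rfl
  obtain ⟨G', -, -, -, hG'id⟩ := ha' amax' hamax' le_rfl
  refine ⟨G.trans (Φ.trans G'.symm), hbelow, hconj, fun x hx => ?_⟩
  -- on the deep part `Ψ = hetMap`
  have hxb : C.S.f x ≤ b - C.S.δ := by rw [hb]; linarith
  have hxb' : C.S.f x ≤ b := by linarith
  have hGx : (G x).1 = x := hGid x hxb
  have hGx' : G x = ⟨x, hxb'⟩ := Subtype.ext hGx
  -- the level of `hetMap x` is at most `b + P.σ - δ`
  have hlev : C.S.f (P.hetMap x) ≤ b + P.σ - C.S.δ := by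
    rcases lt_or_ge (C.S.a - C.S.η / 2) (C.S.f x) with h | h
    · have h' : C.S.f (P.hetMap x) = C.S.f x + P.σ := P.apply_hetMap h (by show C.S.f x ≤ C.S.ℓu; linarith)
      linarith
    · have hlt' : C.S.f x < C.S.a + C.S.η / 2 := by linarith
      rw [P.hetMap_eq_low hlt']
      have h2 : C.S.f (P.low x) < C.S.a - C.S.η / 4 := P.low_below x (by show C.S.f x < C.S.a - C.S.η / 4; linarith)
      rw [hσ, hb, C.ha_eq, C.hℓu_eq, C.hδ_eq] at *
      nlinarith [C.hηε]
  have hlev' : C.S.f (P.hetMap x) ≤ b + P.σ := by linarith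
  have hy : (G' (P.hetMap x)).1 = P.hetMap x := hG'id _ hlev
  have hy' : G' (P.hetMap x) = ⟨P.hetMap x, hlev'⟩ := Subtype.ext hy
  show G'.symm (Φ (G x)) = P.hetMap x
  rw [hGx']
  have hΦx : Φ ⟨x, hxb'⟩ = ⟨P.hetMap x, hlev'⟩ :=
    Subtype.ext (P.diffeomorphSublevel_apply C.toCtx.hn1 hb₁ hb₂ hint hreg' hintσ hregσ' _)
  rw [hΦx, ← hy', Diffeomorph.symm_apply_apply]

end SlideContext


/-! ## Part 2 — below the handle: a flow conjugate, isotopic to the identity -/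


/-! ### The chart correspondence of a chart with itself -/

namespace HandleChart

variable {m : ℕ} {H : Type*} [TopologicalSpace H] {J : ModelWithCorners ℝ (EuclideanSpace ℝ (Fin m)) H}
  {M : Type u} [TopologicalSpace M] [ChartedSpace H M]
  {f : M → ℝ} {X : Π x : M, TangentSpace J x} {p : M} (D : HandleChart J f X p)

/-- **The chart correspondence of a handle chart with itself is the identity** on the chart
domain. [folklore] -/
theorem chartMap_self {q : M} (hq : q ∈ D.chart.source) : D.chartMap D q = q := by
  unfold chartMap coord
  rw [add_sub_cancel]
  exact (D.chart.extend J).left_inv (by rw [D.chart.extend_source]; exact hq)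

end HandleChart

namespace SlideContext

variable {n : ℕ} {M : Type u} [TopologicalSpace M] [ChartedSpace (EuclideanHalfSpace (n + 1)) M]
  [IsManifold (𝓡∂ (n + 1)) ∞ M] [T2Space M] (C : SlideContext n M)
  (ψ : Diffeotopy (𝓡 n) (C.toCtx.Sl'.Level (C.toCtx.c + C.toCtx.σ)))

/-! ### The handle-extension map of a pair with equal sides -/

section HetMap

variable {C}
variable {g g' : M → M} {η₀ : ℝ} {N : ℕ} (hη₀ : C.toCtx.S.η / 2 < η₀) (hη₀' : η₀ ≤ 2 * C.toCtx.S.η / 3)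
  (hA : C.toCtx.c + C.toCtx.τ + N * η₀ = C.toCtx.S.a + 2 * η₀)
  (hP : IsLowerPair C.toCtx.Sl C.toCtx.Sl' C.toCtx.σ (C.toCtx.c + C.toCtx.τ + N * η₀) η₀ g g')
  (hfeet : ∀ {s : ℝ} (hs : s ^ 2 = 1) (w : 𝔼 n), ‖w‖ ≤ 1 → (s = 1 ∨ s = -1) →
    g (C.toCtx.S.D.foot s C.toCtx.m C.toCtx.ρ w) = C.toCtx.S'.D.foot s C.toCtx.m' C.toCtx.ρ w)

/-- **On the handle region the handle-extension map of a pair with equal sides is the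
identity.** [cite: MilnorHCobordism1965, proof of Thm. 3.13 (PDF pp. 18–19)] -/
theorem hetMap_eq_self_of_mem {x : M} (hx : x ∈ C.S.N) : (C.toCtx.pair hη₀ hη₀' hA hP hfeet).hetMap x = x := by
  rw [(C.toCtx.pair hη₀ hη₀' hA hP hfeet).hetMap_of_mem hx]
  exact C.S.D.chartMap_self hx.1

/-- **Below the level `c` the handle-extension map is the seed** `κ` (when the lower pair is
the extended pair of a seed: `g = κ` below `c`). [cite: MilnorHCobordism1965, proof of Thm. 3.13 (PDF pp. 18–19)] -/
theorem hetMap_eq_of_lt {κ : M → M} (hbelow : ∀ x, C.S.f x < C.c → g x = κ x) {x : M} (hx : C.S.f x < C.c) :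
    (C.toCtx.pair hη₀ hη₀' hA hP hfeet).hetMap x = κ x := by
  have hτ := C.τ_pos; have hη := C.S.η_pos
  have hc_le : C.c + 8 * C.τ ≤ C.S.a - 24 * C.S.ε ^ 2 := by
    have := C.toCtx.c_le; simpa only [toCtx_c, toCtx_τ, toCtx_S] using this
  rw [(C.toCtx.pair hη₀ hη₀' hA hP hfeet).hetMap_eq_low (by show C.S.f x < C.S.a + C.S.η / 2; linarith [sq_nonneg C.S.ε])]
  have hA' : C.c + C.τ + N * η₀ = C.S.a + 2 * η₀ := hA
  have hη₀C : C.S.η / 2 < η₀ := hη₀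
  have hη₀C' : η₀ ≤ 2 * C.S.η / 3 := hη₀'
  have hηε := C.hηε
  show (hP.lowerData (C.toCtx.η₀_pos hη₀) (C.toCtx.pair_hlo hη₀' hA) (C.toCtx.pair_hhi hη₀' hA)
    (C.toCtx.pair_hlo' hη₀' hA) (C.toCtx.pair_hhi' hη₀' hA)).low x = κ x
  exact (hP.low_eq (C.toCtx.η₀_pos hη₀) (C.toCtx.pair_hlo hη₀' hA) (C.toCtx.pair_hhi hη₀' hA)
    (C.toCtx.pair_hlo' hη₀' hA) (C.toCtx.pair_hhi' hη₀' hA)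
    (by show C.S.f x ≤ C.c + C.τ + N * η₀ - 3 * η₀; nlinarith [sq_nonneg C.S.ε, C.S.ε_pos])).trans (hbelow x hx)

/-- **On `c ≤ f < a + η/2` the handle-extension map is the flow conjugate of the seed** (when
the lower pair is the extended pair of a seed `κ`). [cite: MilnorHCobordism1965, proofs of Thm. 3.4 (PDF p. 13) and Thm. 3.13 (PDF pp. 18–19)] -/
theorem hetMap_eq_conj {κ : M → M}
    (hconj : ∀ x, C.c ≤ C.S.f x → C.S.f x < C.toCtx.c + C.toCtx.τ + N * η₀ →
      g x = C.S.θ (C.S.f x - C.c, κ (C.S.θ (C.c - C.S.f x, x))))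
    {x : M} (hcx : C.c ≤ C.S.f x) (hx : C.S.f x < C.S.a + C.S.η / 2) :
    (C.toCtx.pair hη₀ hη₀' hA hP hfeet).hetMap x = C.S.θ (C.S.f x - C.c, κ (C.S.θ (C.c - C.S.f x, x))) := by
  have hτ := C.τ_pos; have hη := C.S.η_pos
  have hc_le : C.c + 8 * C.τ ≤ C.S.a - 24 * C.S.ε ^ 2 := by
    have := C.toCtx.c_le; simpa only [toCtx_c, toCtx_τ, toCtx_S] using this
  have hA' : C.c + C.τ + N * η₀ = C.S.a + 2 * η₀ := hA
  have hη₀C : C.S.η / 2 < η₀ := hη₀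
  rw [(C.toCtx.pair hη₀ hη₀' hA hP hfeet).hetMap_eq_low hx]
  show (hP.lowerData (C.toCtx.η₀_pos hη₀) (C.toCtx.pair_hlo hη₀' hA) (C.toCtx.pair_hhi hη₀' hA)
    (C.toCtx.pair_hlo' hη₀' hA) (C.toCtx.pair_hhi' hη₀' hA)).low x = _
  exact hP.low_eq_conj (C.toCtx.η₀_pos hη₀) (C.toCtx.pair_hlo hη₀' hA) (C.toCtx.pair_hhi hη₀' hA)
    (C.toCtx.pair_hlo' hη₀' hA) (C.toCtx.pair_hhi' hη₀' hA) (c := C.c) (g₀ := κ)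
    (by show C.c ≤ C.c + C.τ + N * η₀ - 2 * η₀; linarith [sq_nonneg C.S.ε])
    (fun y hcy hy => hconj y hcy (by show C.S.f y < C.c + C.τ + N * η₀; have : C.S.f y < C.c + C.τ + ↑N * η₀ - η₀ := hy; linarith))
    hcx (by show C.S.f x < C.c + C.τ + N * η₀ + η₀; linarith)

end HetMap

/-! ### The flow line of a point of the seed level -/

omit [T2Space M] in
/-- The level of a point of the seed level. [folklore] -/
theorem apply_levelIncl (v : C.toCtx.Sl'.Level (C.toCtx.c + C.toCtx.σ)) : C.S.f (C.toCtx.Sl'.levelIncl v) = C.c := by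
  have h := C.toCtx.Sl'.apply_coe (c := C.toCtx.c + C.toCtx.σ) rfl v
  have h' : C.S.f (C.toCtx.Sl'.levelIncl v) = C.c + 0 := h
  rw [h', add_zero]

omit [T2Space M] in
/-- **The clock along the flow line of a point of the seed level**: `f (θ (t, v)) = c + t` for
`-4τ < t < a + 2η - c`. [cite: MilnorHCobordism1965, proof of Thm. 3.4 (PDF p. 13)] -/
theorem apply_flow_levelIncl (v : C.toCtx.Sl'.Level (C.toCtx.c + C.toCtx.σ)) {t : ℝ}
    (ht₁ : -4 * C.τ < t) (ht₂ : t < C.S.a + 2 * C.S.η - C.c) :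
    C.S.f (C.S.θ (t, C.toCtx.Sl'.levelIncl v)) = C.c + t := by
  have hv := C.apply_levelIncl v
  have hτ := C.τ_pos; have hη := C.S.η_pos
  have hc_le : C.c + 8 * C.τ ≤ C.S.a - 24 * C.S.ε ^ 2 := by
    have := C.toCtx.c_le; simpa only [toCtx_c, toCtx_τ, toCtx_S] using this
  have h := C.toCtx.Sl.apply_flow (x := C.toCtx.Sl'.levelIncl v)
    (by show C.S.f _ ∈ Ioo C.S.ℓ₁ (C.S.a + 2 * C.S.η); rw [hv, C.hℓ₁_eq]; constructor <;> linarith [sq_nonneg C.S.ε])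
    (t := t) (by show C.S.f _ + t ∈ Ioo C.S.ℓ₁ (C.S.a + 2 * C.S.η); rw [hv, C.hℓ₁_eq]; constructor <;> linarith)
  have h' : C.S.f (C.S.θ (t, C.toCtx.Sl'.levelIncl v)) = C.S.f (C.toCtx.Sl'.levelIncl v) + t := h
  rw [h', hv]

/-! ### The suspension of the truncated diffeotopy, as a jointly continuous family -/

/-- **The family of suspensions**: `suspFamily s` is the suspension of the family of stages
`u ↦ ψ (s u)` (so `suspFamily 0 = id`, `suspFamily 1 = κ`). [cite: MilnorHCobordism1965, proof of Thm. 3.13 (PDF pp. 18–19)] -/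
def suspFamily (s : ℝ) (y : M) : M :=
  C.toCtx.Sl'.suspWith (c := C.toCtx.c + C.toCtx.σ) C.toCtx.τ_pos C.toCtx.lo'_le C.toCtx.le_hi' rfl
    (fun u v => ψ.toFun (s * u) v) y

omit [T2Space M] in
/-- At `s = 1` the family is the suspension `κ` of `ψ`. [folklore] -/
theorem suspFamily_one (y : M) : C.suspFamily ψ 1 y = C.susp ψ y := by
  have h : (fun u v => ψ.toFun (1 * u) v) = ψ.toFun := by funext u v; rw [one_mul]
  show C.toCtx.Sl'.suspWith _ _ _ _ _ y = C.toCtx.Sl'.suspWith _ _ _ _ _ y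
  rw [h]

omit [T2Space M] in
/-- At `s = 0` the family is the identity. [folklore] -/
theorem suspFamily_zero (y : M) : C.suspFamily ψ 0 y = y := by
  have h : (fun u v => ψ.toFun (0 * u) v) = fun (_ : ℝ) (v : C.toCtx.Sl'.Level (C.toCtx.c + C.toCtx.σ)) => v := by
    funext u v; rw [zero_mul, ψ.toFun_zero]; rfl
  show C.toCtx.Sl'.suspWith _ _ _ _ _ y = y
  rw [h]
  exact C.toCtx.Sl'.suspWith_id C.toCtx.τ_pos C.toCtx.lo'_le C.toCtx.le_hi' rfl y

omit [T2Space M] in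
/-- **Off the plateau the family is the identity**: for `f y ≤ c - 2τ` or `c + 3τ ≤ f y`. [folklore] -/
theorem suspFamily_eq_self (s : ℝ) {y : M} (hy : C.S.f y ≤ C.c - 2 * C.τ ∨ C.c + 3 * C.τ ≤ C.S.f y) :
    C.suspFamily ψ s y = y := by
  refine C.toCtx.Sl'.suspWith_eq_self C.toCtx.τ_pos C.toCtx.lo'_le C.toCtx.le_hi' rfl _ (fun v => ?_) ?_
  · show ψ.toFun (s * 0) v = v; rw [mul_zero, ψ.toFun_zero]; rfl
  · show C.S.f y ≤ C.c + 0 - 2 * C.τ ∨ C.c + 0 + 3 * C.τ ≤ C.S.f y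
    simpa using hy

omit [T2Space M] in
/-- **The family on the flow line of a point of the seed level**: `suspFamily s (θ (t, v)) = θ (t, ψ_s v)`
for `t ∈ [-τ, 2τ]`. [cite: MilnorHCobordism1965, proof of Thm. 3.13 (PDF pp. 18–19)] -/
theorem suspFamily_flow (s : ℝ) (v : C.toCtx.Sl'.Level (C.toCtx.c + C.toCtx.σ)) {t : ℝ} (ht : t ∈ Icc (-C.τ) (2 * C.τ)) :
    C.suspFamily ψ s (C.S.θ (t, C.toCtx.Sl'.levelIncl v)) = C.S.θ (t, C.toCtx.Sl'.levelIncl (ψ.toFun s v)) := by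
  have h := C.toCtx.Sl'.suspWith_flow C.toCtx.τ_pos C.toCtx.lo'_le C.toCtx.le_hi' rfl (fun u v => ψ.toFun (s * u) v) v ht
  simp only [mul_one] at h
  exact h

omit [T2Space M] in
/-- In particular on the seed level itself `suspFamily s = ψ_s`. [folklore] -/
theorem suspFamily_levelIncl (s : ℝ) (v : C.toCtx.Sl'.Level (C.toCtx.c + C.toCtx.σ)) :
    C.suspFamily ψ s (C.toCtx.Sl'.levelIncl v) = C.toCtx.Sl'.levelIncl (ψ.toFun s v) := by
  have h := C.suspFamily_flow ψ s v (t := 0) ⟨by linarith [C.τ_pos], by linarith [C.τ_pos]⟩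
  rwa [C.S.isFlowOf.map_zero, C.S.isFlowOf.map_zero] at h

omit [T2Space M] in
/-- **The family is jointly continuous in `(s, y)`.**  On the flow box it is
`θ (f y - c, ψ (s χ(f y - c)) (base y))` in the (smooth) flow coordinates; off the plateau it
is the identity; the two open sets cover. [folklore] -/
theorem continuous_suspFamily : Continuous fun p : ℝ × M => C.suspFamily ψ p.1 p.2 := by
  have hτ := C.τ_pos
  set Sl := C.toCtx.Sl' with hSl
  set c₀ : ℝ := C.toCtx.c + C.toCtx.σ with hc₀
  have hc₀' : c₀ = C.c := add_zero _
  have hθ : Continuous C.S.θ := C.S.flow.contMDiff.continuous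
  have hf : Continuous C.S.f := C.S.hf.continuous
  have hψ : Continuous (uncurry ψ.toFun) := ψ.contMDiff_uncurry_toFun.continuous
  have hbase : Continuous (Sl.baseLevel (c := c₀) C.toCtx.τ_pos C.toCtx.lo'_le C.toCtx.le_hi' rfl) :=
    (Sl.contMDiff_baseLevel (c := c₀) C.toCtx.τ_pos C.toCtx.lo'_le C.toCtx.le_hi' rfl).continuous
  have hχ : Continuous (levelTimeCutoff C.τ) := (levelTimeCutoff.contDiff (τ := C.τ)).continuous
  -- the formula on the box
  set boxset : Set M := {y | C.S.f y ∈ Ioo (c₀ - 3 * C.τ) (c₀ + 4 * C.τ)} with hboxset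
  have hbox_open : IsOpen boxset := isOpen_Ioo.preimage hf
  have hA : ContinuousOn (fun p : ℝ × M => C.suspFamily ψ p.1 p.2) (univ ×ˢ boxset) := by
    rw [continuousOn_iff_continuous_restrict]
    have heq : (univ ×ˢ boxset).restrict (fun p : ℝ × M => C.suspFamily ψ p.1 p.2) =
        fun q : ↥(univ ×ˢ boxset) => C.S.θ (C.S.f q.1.2 - c₀,
          Sl.levelIncl (ψ.toFun (q.1.1 * levelTimeCutoff C.τ (C.S.f q.1.2 - c₀))
            (Sl.baseLevel (c := c₀) C.toCtx.τ_pos C.toCtx.lo'_le C.toCtx.le_hi' rfl ⟨q.1.2, q.2.2⟩))) := by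
      funext q
      show C.suspFamily ψ q.1.1 q.1.2 = _
      exact Sl.suspWith_of_mem (c := c₀) C.toCtx.τ_pos C.toCtx.lo'_le C.toCtx.le_hi' rfl
        (fun u v => ψ.toFun (q.1.1 * u) v) q.2.2
    rw [heq]
    refine hθ.comp (Continuous.prodMk ?_ ?_)
    · exact (hf.comp (continuous_snd.comp continuous_subtype_val)).sub continuous_const
    · refine (continuous_subtype_val.comp continuous_subtype_val).comp (hψ.comp (Continuous.prodMk ?_ ?_))
      · exact (continuous_fst.comp continuous_subtype_val).mul
          (hχ.comp ((hf.comp (continuous_snd.comp continuous_subtype_val)).sub continuous_const))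
      · exact hbase.comp (Continuous.subtype_mk (continuous_snd.comp continuous_subtype_val) _)
  -- pointwise
  rw [continuous_iff_continuousAt]
  rintro ⟨s, y⟩
  by_cases hy : C.S.f y ∈ Ioo (c₀ - 3 * C.τ) (c₀ + 4 * C.τ)
  · exact hA.continuousAt ((isOpen_univ.prod hbox_open).mem_nhds ⟨mem_univ _, hy⟩)
  · -- off the box: the identity on a neighbourhood
    have hy' : C.S.f y ≤ c₀ - 3 * C.τ ∨ c₀ + 4 * C.τ ≤ C.S.f y := by
      by_contra h
      push Not at h
      exact hy ⟨h.1, h.2⟩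
    set U : Set (ℝ × M) := {p | C.S.f p.2 < c₀ - 2 * C.τ ∨ c₀ + 3 * C.τ < C.S.f p.2} with hU
    have hUo : IsOpen U := by
      have h1 : IsOpen {p : ℝ × M | C.S.f p.2 < c₀ - 2 * C.τ} := isOpen_lt (hf.comp continuous_snd) continuous_const
      have h2 : IsOpen {p : ℝ × M | c₀ + 3 * C.τ < C.S.f p.2} := isOpen_lt continuous_const (hf.comp continuous_snd)
      exact h1.union h2
    have hyU : (s, y) ∈ U := by
      rcases hy' with h | h
      · exact Or.inl (by show C.S.f y < c₀ - 2 * C.τ; linarith)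
      · exact Or.inr (by show c₀ + 3 * C.τ < C.S.f y; linarith)
    have heq : ∀ p ∈ U, C.suspFamily ψ p.1 p.2 = p.2 := fun p hp =>
      C.suspFamily_eq_self ψ p.1 (by rcases hp with h | h <;> [left; right] <;> linarith)
    refine (continuous_snd.continuousAt (x := (s, y))).congr ?_
    exact Filter.eventuallyEq_of_mem (hUo.mem_nhds hyU) fun p hp => (heq p hp).symm

/-! ### The homotopy on the sublevel set below the handle -/

/-- The cut level `a - η` of the sublevel set on which the isotopy lives. [folklore] -/
def cut : ℝ := C.S.a - C.S.η

/-- **The drop time** above the seed level: `T x = max (f x - c) 0`. [folklore] -/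
def dropT (x : M) : ℝ := max (C.S.f x - C.c) 0

omit [T2Space M] in
/-- The drop time is continuous. [folklore] -/
theorem continuous_dropT : Continuous C.dropT := (C.S.hf.continuous.sub continuous_const).max continuous_const

/-- **The slide homotopy** on the sublevel set `{f ≤ a - η}`:
`H (s, x) = θ (T x, suspFamily s (θ (-T x, x)))`. [cite: HatcherAT2002, Lemma 1.19]
[cite: MilnorHCobordism1965, proof of Thm. 3.13 (PDF pp. 18–19)] -/
def slideHomotopyFun (s : ℝ) (x : M) : M := C.S.θ (C.dropT x, C.suspFamily ψ s (C.S.θ (-C.dropT x, x)))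

omit [T2Space M] in
/-- The slide homotopy is jointly continuous. [folklore] -/
theorem continuous_slideHomotopyFun : Continuous fun p : ℝ × M => C.slideHomotopyFun ψ p.1 p.2 := by
  have hθ : Continuous C.S.θ := C.S.flow.contMDiff.continuous
  have hT : Continuous C.dropT := C.continuous_dropT
  refine hθ.comp (Continuous.prodMk (hT.comp continuous_snd) ?_)
  exact (C.continuous_suspFamily ψ).comp (Continuous.prodMk continuous_fst
    (hθ.comp (Continuous.prodMk ((hT.comp continuous_snd).neg) continuous_snd)))

omit [T2Space M] in
/-- **At `s = 0` the slide homotopy is the identity.** [folklore] -/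
theorem slideHomotopyFun_zero (x : M) : C.slideHomotopyFun ψ 0 x = x := by
  unfold slideHomotopyFun
  rw [C.suspFamily_zero ψ]
  exact C.toCtx.Sl.flow_flow_neg _ _

omit [T2Space M] in
/-- **At `s = 1` the slide homotopy is the flow conjugate of `κ`.** [folklore] -/
theorem slideHomotopyFun_one (x : M) :
    C.slideHomotopyFun ψ 1 x = C.S.θ (C.dropT x, C.susp ψ (C.S.θ (-C.dropT x, x))) := by
  unfold slideHomotopyFun
  rw [C.suspFamily_one ψ]

omit [T2Space M] in
/-- **Below `c - 3τ` the slide homotopy is constant.** [folklore] -/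
theorem slideHomotopyFun_of_le (s : ℝ) {x : M} (hx : C.S.f x ≤ C.c - 3 * C.τ) : C.slideHomotopyFun ψ s x = x := by
  have hτ := C.τ_pos
  unfold slideHomotopyFun dropT
  rw [max_eq_right (by linarith), neg_zero]
  simp only [C.S.isFlowOf.map_zero]
  exact C.suspFamily_eq_self ψ s (Or.inl (by linarith))

omit [T2Space M] in
/-- **The track of a point of the flow line of a point `v` of the seed level**: for
`0 ≤ t < a + 2η - c`, `H (s, θ (t, v)) = θ (t, ψ_s v)`. [cite: HatcherAT2002, Lemma 1.19] -/
theorem slideHomotopyFun_flow (s : ℝ) (v : C.toCtx.Sl'.Level (C.toCtx.c + C.toCtx.σ)) {t : ℝ} (ht₀ : 0 ≤ t)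
    (ht : t < C.S.a + 2 * C.S.η - C.c) :
    C.slideHomotopyFun ψ s (C.S.θ (t, C.toCtx.Sl'.levelIncl v)) = C.S.θ (t, C.toCtx.Sl'.levelIncl (ψ.toFun s v)) := by
  have hτ := C.τ_pos
  have hlev := C.apply_flow_levelIncl v (by linarith) ht
  unfold slideHomotopyFun dropT
  rw [hlev, show C.c + t - C.c = t by ring, max_eq_left ht₀, C.S.isFlowOf.map_neg_map,
    C.suspFamily_levelIncl ψ s v]

/-- **The slide homotopy on the sublevel set `{f ≤ a - η}`, as a homotopy of continuous maps**
from the inclusion to the map `x ↦ θ (T x, κ (θ (-T x, x)))`. [cite: HatcherAT2002, Lemma 1.19] -/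
def slideHomotopy (Φ : C(M, M)) (hΦ : ∀ x, C.S.f x ≤ C.cut → Φ x = C.S.θ (C.dropT x, C.susp ψ (C.S.θ (-C.dropT x, x)))) :
    ContinuousMap.Homotopy
      (⟨Subtype.val, continuous_subtype_val⟩ : C(↥(C.S.f ⁻¹' Iic C.cut), M))
      (Φ.comp ⟨Subtype.val, continuous_subtype_val⟩) where
  toFun p := C.slideHomotopyFun ψ p.1 p.2.1
  continuous_toFun := (C.continuous_slideHomotopyFun ψ).comp
    ((continuous_subtype_val.comp continuous_fst).prodMk (continuous_subtype_val.comp continuous_snd))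
  map_zero_left x := C.slideHomotopyFun_zero ψ x.1
  map_one_left x := by
    show C.slideHomotopyFun ψ 1 x.1 = Φ x.1
    rw [C.slideHomotopyFun_one ψ, hΦ x.1 x.2]

omit [T2Space M] in
/-- Unfolding. [folklore] -/
@[simp] theorem slideHomotopy_apply (Φ : C(M, M))
    (hΦ : ∀ x, C.S.f x ≤ C.cut → Φ x = C.S.θ (C.dropT x, C.susp ψ (C.S.θ (-C.dropT x, x))))
    (s : I) (x : ↥(C.S.f ⁻¹' Iic C.cut)) :
    C.slideHomotopy ψ Φ hΦ (s, x) = C.slideHomotopyFun ψ s x.1 := rfl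

end SlideContext


/-! ## Part 3 — the effect on the fundamental group -/


namespace SlideContext

variable {n : ℕ} {M : Type u} [TopologicalSpace M] [ChartedSpace (EuclideanHalfSpace (n + 1)) M]
  [IsManifold (𝓡∂ (n + 1)) ∞ M] [T2Space M] (C : SlideContext n M)
  (ψ : Diffeotopy (𝓡 n) (C.toCtx.Sl'.Level (C.toCtx.c + C.toCtx.σ)))

/-! ### The slide diffeomorphism below the handle -/

section Below

variable {C ψ}
variable {g g' : M → M} {η₀ : ℝ} {N : ℕ} (hη₀ : C.toCtx.S.η / 2 < η₀) (hη₀' : η₀ ≤ 2 * C.toCtx.S.η / 3)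
  (hA : C.toCtx.c + C.toCtx.τ + N * η₀ = C.toCtx.S.a + 2 * η₀)
  (hP : IsLowerPair C.toCtx.Sl C.toCtx.Sl' C.toCtx.σ (C.toCtx.c + C.toCtx.τ + N * η₀) η₀ g g')
  (hfeet : ∀ {s : ℝ} (hs : s ^ 2 = 1) (w : 𝔼 n), ‖w‖ ≤ 1 → (s = 1 ∨ s = -1) →
    g (C.toCtx.S.D.foot s C.toCtx.m C.toCtx.ρ w) = C.toCtx.S'.D.foot s C.toCtx.m' C.toCtx.ρ w)
  {Ψ : M ≃ₘ⟮𝓡∂ (n + 1), 𝓡∂ (n + 1)⟯ M}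
  (hbelow : ∀ x, C.S.f x < C.c → g x = C.susp ψ x)
  (hconj : ∀ x, C.c ≤ C.S.f x → C.S.f x < C.toCtx.c + C.toCtx.τ + N * η₀ →
    g x = C.S.θ (C.S.f x - C.c, C.susp ψ (C.S.θ (C.c - C.S.f x, x))))
  (hΨ : ∀ x, C.S.f x ≤ C.S.ℓu - 3 * C.S.δ → Ψ x = (C.toCtx.pair hη₀ hη₀' hA hP hfeet).hetMap x)

omit [T2Space M] in
/-- Arithmetic: the cut level `a - η` lies below `ℓ⁺ - 3δ` and `a + η/2`, above `c`. [folklore] -/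
theorem cut_lt : C.c + C.τ < C.cut ∧ C.cut < C.S.a + C.S.η / 2 ∧ C.cut ≤ C.S.ℓu - 3 * C.S.δ ∧
    C.cut < C.S.a + 2 * C.S.η := by
  have hτ := C.τ_pos; have hη := C.S.η_pos; have hε := C.S.ε_pos; have hδ := C.S.δ_pos
  have hc_le : C.c + 8 * C.τ ≤ C.S.a - 24 * C.S.ε ^ 2 := by
    have := C.toCtx.c_le; simpa only [toCtx_c, toCtx_τ, toCtx_S] using this
  have hηε := C.hηε
  unfold cut
  refine ⟨by nlinarith [sq_nonneg C.S.ε], by linarith, ?_, by linarith⟩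
  rw [C.ha_eq, C.hℓu_eq, C.hδ_eq]; nlinarith [C.hηε]

include hbelow hconj hΨ in
/-- **On `{f ≤ a - η}` the slide diffeomorphism is the flow conjugate of the suspension of the
seed.** [cite: MilnorHCobordism1965, proof of Thm. 3.13 (PDF pp. 18–19)] -/
theorem slide_apply_of_le_cut {x : M} (hx : C.S.f x ≤ C.cut) :
    Ψ x = C.S.θ (C.dropT x, C.susp ψ (C.S.θ (-C.dropT x, x))) := by
  obtain ⟨h1, h2, h3, -⟩ := C.cut_lt
  rw [hΨ x (hx.trans h3)]
  unfold dropT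
  rcases lt_or_ge (C.S.f x) C.c with hlt | hge
  · rw [hetMap_eq_of_lt hη₀ hη₀' hA hP hfeet hbelow hlt, max_eq_right (by linarith), neg_zero,
      C.S.isFlowOf.map_zero, C.S.isFlowOf.map_zero]
  · rw [hetMap_eq_conj hη₀ hη₀' hA hP hfeet hconj hge (lt_of_le_of_lt hx h2), max_eq_left (by linarith),
      neg_sub]

include hconj hΨ in
/-- **`Ψ` fixes the flow line, up to the level `a + η/2`, of every point of the seed level
fixed by the final stage of `ψ`.** [cite: MilnorHCobordism1965, proof of Thm. 3.13 (PDF pp. 18–19)] -/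
theorem slide_flow_levelIncl {v : C.toCtx.Sl'.Level (C.toCtx.c + C.toCtx.σ)} (hv : ψ.toFun 1 v = v)
    {t : ℝ} (ht₀ : 0 ≤ t) (ht : t < C.S.a + C.S.η / 2 - C.c) :
    Ψ (C.S.θ (t, C.toCtx.Sl'.levelIncl v)) = C.S.θ (t, C.toCtx.Sl'.levelIncl v) := by
  have hτ := C.τ_pos; have hη := C.S.η_pos; have hε := C.S.ε_pos; have hδ := C.S.δ_pos
  have hlev := C.apply_flow_levelIncl v (t := t) (by linarith) (by linarith)
  have hdeep : C.S.f (C.S.θ (t, C.toCtx.Sl'.levelIncl v)) ≤ C.S.ℓu - 3 * C.S.δ := by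
    rw [hlev, C.ha_eq, C.hℓu_eq, C.hδ_eq] at *; nlinarith [C.hηε]
  rw [hΨ _ hdeep, hetMap_eq_conj hη₀ hη₀' hA hP hfeet hconj (by rw [hlev]; linarith) (by rw [hlev]; linarith), hlev,
    show C.c + t - C.c = t by ring, show C.c - (C.c + t) = -t by ring, C.S.isFlowOf.map_neg_map,
    C.susp_levelIncl, hv]

include hΨ in
/-- **`Ψ` is the identity on the handle region below `ℓ⁺ - 3δ`.** [cite: MilnorHCobordism1965, proof of Thm. 3.13 (PDF pp. 18–19)] -/
theorem slide_eq_self_of_mem_N {x : M} (hx : x ∈ C.S.N) (hxu : C.S.f x ≤ C.S.ℓu - 3 * C.S.δ) : Ψ x = x := by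
  rw [hΨ x hxu, hetMap_eq_self_of_mem hη₀ hη₀' hA hP hfeet hx]

include hbelow hΨ in
/-- **`Ψ` is the suspension `κ` below the level `c`**, in particular the identity below
`c - 2τ`. [cite: MilnorHCobordism1965, proof of Thm. 3.13 (PDF pp. 18–19)] -/
theorem slide_apply_of_lt {x : M} (hx : C.S.f x < C.c) : Ψ x = C.susp ψ x := by
  have hτ := C.τ_pos
  obtain ⟨h1, -, h3, -⟩ := C.cut_lt
  rw [hΨ x (by linarith), hetMap_eq_of_lt hη₀ hη₀' hA hP hfeet hbelow hx]

end Below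

/-! ### The inclusion below the handle and the slide map -/

/-- The inclusion of `X = {f ≤ a - η}`. [folklore] -/
abbrev inclCut : C(↥(C.S.f ⁻¹' Iic C.cut), M) := ⟨Subtype.val, continuous_subtype_val⟩

omit [T2Space M] in
variable {C} in
/-- A self-diffeomorphism as a continuous self-map. [folklore] -/
abbrev slideMap (Ψ : M ≃ₘ⟮𝓡∂ (n + 1), 𝓡∂ (n + 1)⟯ M) : C(M, M) := ⟨Ψ, Ψ.continuous⟩

/-! ### The points and paths of the slide -/

/-- The flow time from the seed level to the cut level, `a - η - c`. [folklore] -/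
def tcut : ℝ := C.cut - C.c

omit [T2Space M] in
/-- `0 ≤ a - η - c`. [folklore] -/
theorem tcut_nonneg : 0 ≤ C.tcut := by unfold tcut; linarith [C.cut_lt.1, C.τ_pos]

omit [T2Space M] in
/-- `a - η - c < a + η/2 - c` and `< a + 2η - c`. [folklore] -/
theorem tcut_lt : C.tcut < C.S.a + C.S.η / 2 - C.c ∧ C.tcut < C.S.a + 2 * C.S.η - C.c := by
  unfold tcut; exact ⟨by linarith [C.cut_lt.2.1], by linarith [C.cut_lt.2.2.2]⟩

/-- **The point of the cut level on the flow line of a point `v` of the seed level**, as a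
point of `X = {f ≤ a - η}`. [folklore] -/
def cutPoint (v : C.toCtx.Sl'.Level (C.toCtx.c + C.toCtx.σ)) : ↥(C.S.f ⁻¹' Iic C.cut) :=
  ⟨C.S.θ (C.tcut, C.toCtx.Sl'.levelIncl v), by
    show C.S.f _ ≤ C.cut
    rw [C.apply_flow_levelIncl v (by linarith [C.tcut_nonneg, C.τ_pos]) C.tcut_lt.2]
    unfold tcut; linarith⟩

omit [T2Space M] in
/-- Unfolding. [folklore] -/
@[simp] theorem cutPoint_coe (v : C.toCtx.Sl'.Level (C.toCtx.c + C.toCtx.σ)) :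
    (C.cutPoint v : M) = C.S.θ (C.tcut, C.toCtx.Sl'.levelIncl v) := rfl

/-- **The flowed-up track** of a point `v` of the seed level fixed by `ψ₁`: the loop
`s ↦ θ (a - η - c, ψ_s v)` at the cut point of `v`. [cite: HatcherAT2002, Lemma 1.19] -/
def cutTrack {v : C.toCtx.Sl'.Level (C.toCtx.c + C.toCtx.σ)} (hv : ψ.toFun 1 v = v) :
    Path (C.cutPoint v : M) (C.cutPoint v : M) where
  toFun s := C.S.θ (C.tcut, C.toCtx.Sl'.levelIncl (ψ.toFun s v))
  continuous_toFun := by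
    refine C.S.flow.contMDiff.continuous.comp (continuous_const.prodMk ?_)
    exact (continuous_subtype_val.comp continuous_subtype_val).comp
      (ψ.contMDiff_uncurry_toFun.continuous.comp (continuous_subtype_val.prodMk continuous_const))
  source' := by simp only [Set.Icc.coe_zero, ψ.toFun_zero]; rfl
  target' := by simp only [Set.Icc.coe_one, hv]; rfl

/-- **The track in the seed level** of a point `v` fixed by `ψ₁`: the loop `s ↦ ψ_s v` read in
`M`. [cite: HatcherAT2002, Lemma 1.19] -/
def levelTrack {v : C.toCtx.Sl'.Level (C.toCtx.c + C.toCtx.σ)} (hv : ψ.toFun 1 v = v) :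
    Path (C.toCtx.Sl'.levelIncl v) (C.toCtx.Sl'.levelIncl v) where
  toFun s := C.toCtx.Sl'.levelIncl (ψ.toFun s v)
  continuous_toFun := (continuous_subtype_val.comp continuous_subtype_val).comp
    (ψ.contMDiff_uncurry_toFun.continuous.comp (continuous_subtype_val.prodMk continuous_const))
  source' := by simp only [Set.Icc.coe_zero, ψ.toFun_zero]; rfl
  target' := by simp only [Set.Icc.coe_one, hv]

/-- **The orbit segment** from a point `v` of the seed level up to its cut point. [folklore] -/
def cutOrbit (v : C.toCtx.Sl'.Level (C.toCtx.c + C.toCtx.σ)) : Path (C.toCtx.Sl'.levelIncl v) (C.cutPoint v : M) :=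
  FlowTrack.orbitPath C.S.flow.contMDiff.continuous C.S.isFlowOf.map_zero C.tcut (C.toCtx.Sl'.levelIncl v)

omit [T2Space M] in
/-- **The track in the level and the flowed-up track are conjugate by the orbit segment**:
`[λ] = [O] · [τ] · [O]⁻¹`. [cite: HatcherAT2002, Lemma 1.19] -/
theorem mk_levelTrack_eq {v : C.toCtx.Sl'.Level (C.toCtx.c + C.toCtx.σ)} (hv : ψ.toFun 1 v = v) :
    Path.Homotopic.Quotient.mk (C.levelTrack ψ hv) =
      ((Path.Homotopic.Quotient.mk (C.cutOrbit v)).trans (Path.Homotopic.Quotient.mk (C.cutTrack ψ hv))).trans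
        (Path.Homotopic.Quotient.mk (C.cutOrbit v)).symm :=
  FlowTrack.mk_eq_trans_trans_symm_of_forall_eq C.S.flow.contMDiff.continuous C.S.isFlowOf.map_zero
    (C.levelTrack ψ hv) C.tcut (C.cutOrbit v) (C.cutOrbit v) (C.cutTrack ψ hv)
    (fun _ => rfl) (fun _ => rfl) (fun _ => rfl)

/-! ### The effect on `π₁` -/

section Pi1

variable {C ψ}
variable {g g' : M → M} {η₀ : ℝ} {N : ℕ} (hη₀ : C.toCtx.S.η / 2 < η₀) (hη₀' : η₀ ≤ 2 * C.toCtx.S.η / 3)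
  (hA : C.toCtx.c + C.toCtx.τ + N * η₀ = C.toCtx.S.a + 2 * η₀)
  (hP : IsLowerPair C.toCtx.Sl C.toCtx.Sl' C.toCtx.σ (C.toCtx.c + C.toCtx.τ + N * η₀) η₀ g g')
  (hfeet : ∀ {s : ℝ} (hs : s ^ 2 = 1) (w : 𝔼 n), ‖w‖ ≤ 1 → (s = 1 ∨ s = -1) →
    g (C.toCtx.S.D.foot s C.toCtx.m C.toCtx.ρ w) = C.toCtx.S'.D.foot s C.toCtx.m' C.toCtx.ρ w)
  {Ψ : M ≃ₘ⟮𝓡∂ (n + 1), 𝓡∂ (n + 1)⟯ M}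
  (hbelow : ∀ x, C.S.f x < C.c → g x = C.susp ψ x)
  (hconj : ∀ x, C.c ≤ C.S.f x → C.S.f x < C.toCtx.c + C.toCtx.τ + N * η₀ →
    g x = C.S.θ (C.S.f x - C.c, C.susp ψ (C.S.θ (C.c - C.S.f x, x))))
  (hΨ : ∀ x, C.S.f x ≤ C.S.ℓu - 3 * C.S.δ → Ψ x = (C.toCtx.pair hη₀ hη₀' hA hP hfeet).hetMap x)

include hbelow hconj hΨ in
/-- The hypothesis of `slideHomotopy` for `Ψ`. [folklore] -/
theorem slide_hΦ : ∀ x, C.S.f x ≤ C.cut → slideMap Ψ x = C.S.θ (C.dropT x, C.susp ψ (C.S.θ (-C.dropT x, x))) :=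
  fun _ hx => slide_apply_of_le_cut hη₀ hη₀' hA hP hfeet hbelow hconj hΨ hx

include hbelow hconj hΨ in
/-- **`Ψ_#` fixes the classes of the loops of `X = {f ≤ a - η}`** based at a point `x₀` below
`c - 3τ` (Laudenbach–Poénaru: "`Φ(xᵢ) = xᵢ` for the other generators"; Hatcher's Lemma 1.19
with the constant track of `x₀`). [cite: LaudenbachPoenaruBSMF1972, §2, proof of Lemma 2 (p. 340)]
[cite: HatcherAT2002, Lemma 1.19] -/
theorem mapOfEq_slide_loop {x₀ : ↥(C.S.f ⁻¹' Iic C.cut)} (hx₀ : C.S.f x₀.1 ≤ C.c - 3 * C.τ)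
    (hΨx₀ : slideMap Ψ (C.inclCut x₀) = C.inclCut x₀) (β : Path x₀ x₀) :
    FundamentalGroup.mapOfEq (slideMap Ψ) hΨx₀
        (FundamentalGroup.fromPath (Path.Homotopic.Quotient.mk (β.map (map_continuous C.inclCut)))) =
      FundamentalGroup.fromPath (Path.Homotopic.Quotient.mk (β.map (map_continuous C.inclCut))) :=
  IsotopyTrack.mapOfEq_mk_map_loop C.inclCut (slideMap Ψ)
    (C.slideHomotopy ψ (slideMap Ψ) (slide_hΦ hη₀ hη₀' hA hP hfeet hbelow hconj hΨ))
    (fun t => C.slideHomotopyFun_of_le ψ t hx₀) hΨx₀ β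

include hbelow hconj hΨ in
/-- **The slide formula** (Laudenbach–Poénaru's `H₃`, p. 340: `x₁ ↦ x₁x₂`; Hatcher's Lemma 1.19).
With the centres `v₋`, `v₊` of the two flowed-down feet discs (`v₋` fixed by every stage of
`ψ`, `v₊` by the final stage), their cut points `y± = θ (a - η - c, v±)`, paths `α± : x₀ ⟶ y±`
in `X`, and a path `K : y₋ ⟶ y₊` in `M` fixed pointwise by `Ψ`:
`Ψ_# [α₋ · K · α₊⁻¹] = [α₋ · K · α₊⁻¹] · [α₊ · τ₊ · α₊⁻¹]⁻¹`, `τ₊` the flowed-up track of `v₊`.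
[cite: LaudenbachPoenaruBSMF1972, §2, proof of Lemma 2 (p. 340)] [cite: HatcherAT2002, Lemma 1.19] -/
theorem mapOfEq_slide_arcLoop {x₀ : ↥(C.S.f ⁻¹' Iic C.cut)} (hx₀ : C.S.f x₀.1 ≤ C.c - 3 * C.τ)
    (hΨx₀ : slideMap Ψ (C.inclCut x₀) = C.inclCut x₀)
    {vm vp : C.toCtx.Sl'.Level (C.toCtx.c + C.toCtx.σ)} (hvm : ∀ s, ψ.toFun s vm = vm) (hvp : ψ.toFun 1 vp = vp)
    (αm : Path x₀ (C.cutPoint vm)) (αp : Path x₀ (C.cutPoint vp))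
    (K : Path (C.cutPoint vm : M) (C.cutPoint vp : M)) (hK : ∀ s, Ψ (K s) = K s) :
    FundamentalGroup.mapOfEq (slideMap Ψ) hΨx₀
        (FundamentalGroup.fromPath (Path.Homotopic.Quotient.mk
          (((αm.map (map_continuous C.inclCut)).trans K).trans (αp.map (map_continuous C.inclCut)).symm))) =
      FundamentalGroup.fromPath
        ((Path.Homotopic.Quotient.mk
          (((αm.map (map_continuous C.inclCut)).trans K).trans (αp.map (map_continuous C.inclCut)).symm)).trans
         (Path.Homotopic.Quotient.mk
          (((αp.map (map_continuous C.inclCut)).trans (C.cutTrack ψ hvp)).trans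
            (αp.map (map_continuous C.inclCut)).symm)).symm) := by
  refine IsotopyTrack.mapOfEq_mk_arcLoop_of_slide C.inclCut (slideMap Ψ)
    (C.slideHomotopy ψ (slideMap Ψ) (slide_hΦ hη₀ hη₀' hA hP hfeet hbelow hconj hΨ))
    (fun t => C.slideHomotopyFun_of_le ψ t hx₀) hΨx₀ αm αp K hK (fun t => ?_) (C.cutTrack ψ hvp) (fun t => ?_)
  · -- the track of `y₋` is constant
    show C.slideHomotopyFun ψ t (C.S.θ (C.tcut, C.toCtx.Sl'.levelIncl vm)) = C.S.θ (C.tcut, C.toCtx.Sl'.levelIncl vm)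
    rw [C.slideHomotopyFun_flow ψ t vm C.tcut_nonneg C.tcut_lt.2, hvm t]
  · -- the track of `y₊` is the flowed-up track
    show C.slideHomotopyFun ψ t (C.S.θ (C.tcut, C.toCtx.Sl'.levelIncl vp)) = C.S.θ (C.tcut, C.toCtx.Sl'.levelIncl (ψ.toFun t vp))
    exact C.slideHomotopyFun_flow ψ t vp C.tcut_nonneg C.tcut_lt.2

end Pi1

end SlideContext

end Literature.Topology.FourManifolds
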